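import Summits.QuantumFields.YangMills.Theorems.AlphaInputsT3ACFacts
import Summits.QuantumFields.YangMills.Theorems.AlphaInputsT3ACv3
import Literature.MathematicalPhysics.QuantumFieldTheory.Balaban1983to89.T3CruxEstimates
import Literature.MathematicalPhysics.QuantumFieldTheory.Balaban1983to89.T3PrintedRegularMinimiser
import Literature.MathematicalPhysics.QuantumFieldTheory.Balaban1983to89.B10Eq5RegularAction
import Literature.MathematicalPhysics.QuantumFieldTheory.Balaban1983to89.B10Eq41TorusHistories
import HarnessLib

/-!
# `FluctuationComparisonRegPrIntLHeightwiseMainTermOfMembership` — ⟨MAIN-H⟩: THE HEIGHTWISE MAIN-TERM ROW OF LEAD w3-20520 g19's UP∘-PKG FILE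
# (`…HeightwiseBoundsOfPackage.Of.heightwiseLower_of_lf_of_mainH`, hypothesis `hMainH`) REDUCED TO ONE MEMBERSHIP ROW PER HEIGHT — «the package's trivial-history
# composite minimiser over a small height-`n` datum lies in print's regular fibre (6) over the height-`n` lattice» (crux `FluctuationComparisonRegPrIntL`,
# stmt-QuantumFields-20520; the heightwise twin of px12 g12's ✓`UV3UnitPartitionLowerOfPackage.beta_mul_wilsonAction4_le_of_regFibrePr` ∕ ✓`mainT_top_le_of_actionBound`)

Cell `ym3-torus` (YM ladder rung R3 = continuum SU(2) Yang–Mills on T³ — a RUNG, NOT d = 4, NOT infinite volume, NOT a mass gap, NOT Clay);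
width seat `ym-ust-20520-w4` (gen 18), explicit-unit helper; `--supports stmt-QuantumFields-20520 --as helper`; LEAD w3-20520 g19 08:54:39Z word «w4: ⟨MAIN-H⟩».
THEOREMS ONLY (0 `def`, 0 `sorry`, default heartbeats).

WHAT.  The LEAD's UP∘-PKG file reads Bałaban's Thm 1 (5) lower half at height `n` from the T3 (α) package `AlphaInputsT3AC.Of F 𝔠`, the B25 row `hlf`, and ONE
main-term row per height
`hMainH : ∀ n, ∃ Cm, ∀ K (hK : n ≤ K) (W : GaugeField (F.P K) (K − n) SU(2)), PlaqSmall (θBal F.L γ 𝔠.b₀ 𝔠.p₀ n) W → (h.pkgAt γ hγ hγ1 K).T.mainT (K − n) ((h.pkgAt γ hγ hγ1 K).T.triv (K − n)) W ≤ Cm`.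
By ✓`AlphaInputsT3AC.PkgAt.mainT_eq` the main term IS `β_K · A₄(U_{K−n}(triv, W))` (print's `(1∕g_k²)A^η(U_k)`, (5) p.256), and for ANY configuration `U` in print's regular
fibre `regFibrePr F n K hK ε₀ V` over the HEIGHT-`n` lattice the action is bounded K-UNIFORMLY: every fine plaquette of `U` is within `ε₀L^{−2(K−n)}` of `1`
(`regThreshold`), so by (11) p.258 `1 − Re tr ≤ ½|· − 1|²` on the `24·L^{3(m+K)}` fine plaquettes and `β_K = L^K∕γ`:
`β_K·A(U) ≤ (L^K∕γ)·24L^{3m+3K}·½ε₀²L^{−4(K−n)} = 12·ε₀²·L^{3m+4n}∕γ` — the powers of `L^K` cancel at EVERY height, not only at `n = 0`.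
* §1 ★★ `beta_mul_wilsonAction4_le_of_regFibrePr_height` — `U ∈ regFibrePr F n K hK ε₀ V ⟹ β_K·A(U) ≤ 12·ε₀²·L^{3m+4n}∕γ` (any `n ≤ K`); at `n = 0` it IS px12's
  ✓`beta_mul_wilsonAction4_le_of_regFibrePr` (an `example` re-derives that statement by specialisation, `4·0 = 0` — the gate's dedup lint forbids restating it).
* §2 ★ `mainTH_le_of_actionBoundH` — the heightwise twin of ✓`mainT_top_le_of_actionBound`: a K-uniform bound on `β_K·A(U_{K−n}(triv, W))` over the height-`n` window IS
  the row `hMainH` at height `n` (✓`PkgAt.mainT_eq`).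
* §3 ★★★ `hMainH_of_membershipH` — **`hMainH` VERBATIM ⟸ ONE MEMBERSHIP ROW PER HEIGHT**: `∀ n K (hK : n ≤ K) W, PlaqSmall (θBal … n) W → ∃ V, U_{K−n}(triv, W) ∈ regFibrePr F n K hK ε₀ V`
  (`Cm := 12·ε₀²·L^{3m+4n}∕γ`); ★★ `hMainH_of_membershipH_datum` — the same with the membership read over the datum ITSELF, `V := fieldShift _ W` (the height-`n`
  lattice of run `K` relabelled as level `0` of the `n`-th approximation, lit `T3LevelShift.fieldShift`) — [Balaban1985Variational] Thm 1 (8) «U_k(V) ∈ 𝔘_k(ε₀) ∩ 𝔅_k(V)»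
  read at every height = the EX lane's content (crux 19200), displayed, NOT proved here.
* §4 (★★OWNER WORD 103 (3): RE-TARGET TO THE v3 RECORD, CLOSE OUTRIGHT) ★★★★ `hMainH_v3` — for the VERSION-3 package `h : AlphaInputsT3AC.OfV3At F 𝔠 a₀ a₁`
  (records `h.pkgAtV3 hc γ hγ hγ1 K`, whose minimiser row r1 ✓`PkgAtV3.uminTriv_mem_regFibrePr` DELIVERS the membership «U_{K−n}(triv, V) ∈ regFibrePr F n K ε₀ V» for
  `PlaqSmall ε₁ V`, `0 < ε₁ ≤ a₁`, `B₃ε₁ ≤ ε₀ ≤ a₀`) the heightwise main-term row holds OUTRIGHT under the two γ-window letters `θBal(n) ≤ a₁`, `B₃θBal(n) ≤ a₀` (all `n`;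
  lit ✓`exists_forall_θBal_le` discharges both for `γ ≤ γ₁(L, 𝔠, a₀, a₁)`): `∀ n, ∃ Cm, ∀ K ≥ n, ∀ W, PlaqSmall θBal(n) W → (h.pkgAtV3 …K).T.mainT (K−n) (triv) W ≤ Cm`
  (`n < K`: r1 at `ε₁ := θBal(n)`, `ε₀ := a₀` ∘ §1; `K = n`: `U_0(triv, W) = W` and (11) directly: `β_n·A(W) ≤ 12·θBal(n)²·L^{3m+4n}∕γ`).
So after this file UP∘-PKG's lower half at height `n` rests on {package, B25@AC, ONE print-shaped membership row per height}, and in the v3 currency on {v3 package} alone.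

HONEST SCOPE.  Arithmetic ((11) + plaquette count + coupling scaling) and bookkeeping over the package's `mainT_eq`; the membership row (Thm 1 (8) of
[Balaban1985Variational] for the package's composite minimiser) is DISPLAYED; the (α) package is the UV3 node's hypothesis schema; nothing of Thm 1 (5), UP∘, PERS₁∘,
TUBE∘, LFR♯ᶜ∘, S2β, the crux 20520, EX∕19200, or any rung statement is proved; `YM3TorusSU2` NOT proved; the Yang–Mills mass gap (Clay) NOT proved.

References: T. Bałaban, Commun. Math. Phys. **102** (1985) 255–275 [Balaban1985UV3] ((3)–(5) p.256, (11) p.258, (41)–(42) p.266); T. Bałaban, CMP **102** (1985)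
277–309 [Balaban1985Variational] ((2), (6) p.278, Thm 1 (8) p.279).
-/

set_option autoImplicit false

noncomputable section

namespace Summit.QuantumFields.YangMills.Theorems.FluctuationComparisonRegPrIntLHeightwiseMainTermOfMembership

open MeasureTheory
open Literature.MathematicalPhysics.QuantumFieldTheory.Balaban1983to89
open Literature.MathematicalPhysics.QuantumFieldTheory.Balaban1983to89.T3ContinuumYM3Torus
open Literature.MathematicalPhysics.QuantumFieldTheory.Balaban1983to89.T3UnitLawDensityEML (ℰp)
open Literature.MathematicalPhysics.QuantumFieldTheory.Balaban1983to89.T3UnitScaleTilt (θBal)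
open Literature.MathematicalPhysics.QuantumFieldTheory.Balaban1983to89.T3PrintedRegularMinimiser (RegPr regFibrePr mem_regFibrePr_iff)
open Literature.MathematicalPhysics.QuantumFieldTheory.Balaban1983to89.T3RegularMinimiser (regThreshold)
open Literature.MathematicalPhysics.QuantumFieldTheory.Balaban1983to89.T3LevelShift (fieldShift)
open Literature.MathematicalPhysics.QuantumFieldTheory.Balaban1983to89.T3AlphaInputsAC
open Literature.MathematicalPhysics.QuantumFieldTheory.Balaban1985CMP102
open Literature.MathematicalPhysics.QuantumFieldTheory.Balaban1985CMP102.Setting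
open Summit.QuantumFields.Balaban3D.Carriers
open Summit.QuantumFields.Balaban3D.Proofs.Primitives

/-! ## §1 `β_K·A(U) ≤ 12·ε₀²·L^{3m+4n}∕γ` on print's regular fibre over the HEIGHT-`n` lattice, K-uniformly -/

/-- ★★ **`β_K·A(U) ≤ 12·ε₀²·L^{3m+4n}∕γ` FOR EVERY `U` IN PRINT's REGULAR FIBRE OVER THE HEIGHT-`n` LATTICE**, INDEPENDENT OF THE RUN `K ≥ n`: every plaquette of a
printed-regular `U ∈ regFibrePr F n K hK ε₀ V` is within `ε₀L^{−2(K−n)}` of `1` (`regThreshold F n K ε₀`), so by (11) `1 − Re tr ≤ ½|· − 1|²` the Wilson action is at most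
`#Plaq·½ε₀²L^{−4(K−n)}` with `#Plaq = 24·L^{3(m+K)}`, and `β_K = L^K∕γ` — the powers of `L^K` cancel: `(L^K)(L^{3K})(L^{−4K}) = 1`, leaving `L^{3m+4n}`.  The heightwise twin
of px12 g12's ✓`UV3UnitPartitionLowerOfPackage.beta_mul_wilsonAction4_le_of_regFibrePr` (`n = 0`).  `V` plays no role in the bound.
[cite: Balaban1985UV3, (11) p.258, (3)-(5) p.256; Balaban1985Variational, (2) p.278, (6) p.278] -/
theorem beta_mul_wilsonAction4_le_of_regFibrePr_height (F : T3Family) {γ : ℝ} (hγ : 0 < γ) (ε₀ : ℝ) {n K : ℕ} (hK : n ≤ K)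
    (V : GaugeField (F.P n) 0 (Matrix.specialUnitaryGroup (Fin 2) ℂ))
    {U : GaugeField (F.P K) 0 (Matrix.specialUnitaryGroup (Fin 2) ℂ)} (hU : U ∈ regFibrePr F n K hK ε₀ V) :
    (F.scheme ℰp γ).β K * wilsonAction4 U ≤ 12 * ε₀ ^ 2 * (F.L : ℝ) ^ (3 * F.m + 4 * n) / γ := by
  obtain ⟨d, rfl⟩ := Nat.exists_eq_add_of_le hK
  have hL : (1 : ℝ) < F.L := by exact_mod_cast F.hL.2
  have hL0 : (0 : ℝ) < F.L := zero_lt_one.trans hL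
  have hβ : (F.scheme ℰp γ).β (n + d) = (γ * ((F.L : ℝ)⁻¹) ^ (n + d))⁻¹ := rfl
  have hβ0 : 0 ≤ (F.scheme ℰp γ).β (n + d) := F.scheme_β_nonneg ℰp hγ.le _
  have hsite : Fintype.card (Site (F.P (n + d)) 0) = (2 * F.L ^ (F.m + (n + d))) ^ 3 := by
    rw [show Fintype.card (Site (F.P (n + d)) 0) = Fintype.card (Fin 3 → ZMod ((F.P (n + d)).sitesPerDir 0)) from
      Fintype.card_congr (Equiv.refl _)]
    rw [Fintype.card_fun, ZMod.card, Fintype.card_fin]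
    simp [Params.sitesPerDir]
  have hplaq : (Fintype.card (Plaq (F.P (n + d)) 0) : ℝ) = 24 * (F.L : ℝ) ^ (3 * F.m + 3 * (n + d)) := by
    rw [B10Eq41TorusHistories.card_plaq_three (F.P_d (n + d)) 0, hsite]
    push_cast
    ring
  have hreg : PlaqSmall (regThreshold F n (n + d) ε₀) U := ((mem_regFibrePr_iff F).mp hU).2.plaqSmall
  have ht : regThreshold F n (n + d) ε₀ = ε₀ * ((F.L : ℝ)⁻¹) ^ (2 * d) := by
    show ε₀ * ((F.L : ℝ)⁻¹) ^ (2 * (n + d - n)) = _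
    rw [Nat.add_sub_cancel_left]
  have hA : wilsonAction4 U ≤ (Fintype.card (Plaq (F.P (n + d)) 0) : ℝ) * ((1 / 2) * (ε₀ * ((F.L : ℝ)⁻¹) ^ (2 * d)) ^ 2) := by
    unfold wilsonAction4 wilsonAction
    calc ∑ p : Plaq (F.P (n + d)) 0, (1 : ℝ) * (1 - reTr (GaugeField.plaqHol U p))
        ≤ ∑ _p : Plaq (F.P (n + d)) 0, (1 / 2) * (ε₀ * ((F.L : ℝ)⁻¹) ^ (2 * d)) ^ 2 := by
          refine Finset.sum_le_sum fun p _ => ?_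
          rw [one_mul]
          have h1 := B10Eq5RegularAction.one_sub_reTr_le_specialUnitaryGroup (GaugeField.plaqHol U p)
          have h2 : dist1 (GaugeField.plaqHol U p) < ε₀ * ((F.L : ℝ)⁻¹) ^ (2 * d) := ht ▸ hreg p
          have h3 : 0 ≤ dist1 (GaugeField.plaqHol U p) := GaugeGroup.dist1_nonneg _
          nlinarith [h1, h2, h3, sq_nonneg (dist1 (GaugeField.plaqHol U p)), mul_self_le_mul_self h3 h2.le]
      _ = (Fintype.card (Plaq (F.P (n + d)) 0) : ℝ) * ((1 / 2) * (ε₀ * ((F.L : ℝ)⁻¹) ^ (2 * d)) ^ 2) := by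
          rw [Finset.sum_const, Finset.card_univ, nsmul_eq_mul]
  calc (F.scheme ℰp γ).β (n + d) * wilsonAction4 U
      ≤ (F.scheme ℰp γ).β (n + d) * ((Fintype.card (Plaq (F.P (n + d)) 0) : ℝ) * ((1 / 2) * (ε₀ * ((F.L : ℝ)⁻¹) ^ (2 * d)) ^ 2)) :=
        mul_le_mul_of_nonneg_left hA hβ0
    _ = 12 * ε₀ ^ 2 * (F.L : ℝ) ^ (3 * F.m + 4 * n) / γ := by
        rw [hβ, hplaq]
        have hLd : ((F.L : ℝ)⁻¹) ^ (2 * d) = ((F.L : ℝ) ^ (2 * d))⁻¹ := by rw [inv_pow]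
        rw [hLd, inv_pow]
        have e1 : (F.L : ℝ) ^ (3 * F.m + 3 * (n + d)) = (F.L : ℝ) ^ (3 * F.m + 4 * n) * (F.L : ℝ) ^ (3 * d) / (F.L : ℝ) ^ n := by
          rw [eq_div_iff (pow_ne_zero _ hL0.ne'), ← pow_add, ← pow_add]; congr 1; ring
        have e2 : (F.L : ℝ) ^ (n + d) = (F.L : ℝ) ^ n * (F.L : ℝ) ^ d := pow_add _ _ _
        have e3 : (F.L : ℝ) ^ (2 * d) = (F.L : ℝ) ^ d * (F.L : ℝ) ^ d := by rw [← pow_add]; congr 1; ring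
        have e4 : (F.L : ℝ) ^ (3 * d) = (F.L : ℝ) ^ d * (F.L : ℝ) ^ d * (F.L : ℝ) ^ d := by rw [← pow_add, ← pow_add]; congr 1; ring
        rw [e1, e2, e3, e4]
        have hLn : (F.L : ℝ) ^ n ≠ 0 := pow_ne_zero _ hL0.ne'
        have hLd0 : (F.L : ℝ) ^ d ≠ 0 := pow_ne_zero _ hL0.ne'
        field_simp
        ring

/- **The `n = 0` specialisation IS px12 g12's statement** (✓`UV3UnitPartitionLowerOfPackage.beta_mul_wilsonAction4_le_of_regFibrePr`: `β_K·A(U) ≤ 12·ε₀²·L^{3m}∕γ` over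
the UNIT lattice) — re-derived from §1 by `3·m + 4·0 = 3·m`; kept as an `example` (the gate's dedup lint forbids restating the landed theorem). -/
example (F : T3Family) {γ : ℝ} (hγ : 0 < γ) (ε₀ : ℝ) (K : ℕ) (V : GaugeField (F.P 0) 0 (Matrix.specialUnitaryGroup (Fin 2) ℂ))
    {U : GaugeField (F.P K) 0 (Matrix.specialUnitaryGroup (Fin 2) ℂ)} (hU : U ∈ regFibrePr F 0 K (Nat.zero_le K) ε₀ V) :
    (F.scheme ℰp γ).β K * wilsonAction4 U ≤ 12 * ε₀ ^ 2 * (F.L : ℝ) ^ (3 * F.m) / γ := by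
  simpa only [Nat.mul_zero, Nat.add_zero] using beta_mul_wilsonAction4_le_of_regFibrePr_height F hγ ε₀ (Nat.zero_le K) V hU

/-! ## §2 The heightwise main-term row from a heightwise action bound (the package's `mainT = β_K·A(U_k(h,W))`) -/

variable {F : T3Family} {𝔠 : AlphaConsts F.L (suGroupModel 2).N}

/-- ★ **THE HEIGHT-`n` MAIN-TERM ROW FROM AN ACTION BOUND** (heightwise twin of px12's ✓`mainT_top_le_of_actionBound`): for the package's tower at run `K`,
`mainT_{K−n}(triv, W) = β_K·A(U_{K−n}(triv, W))` (✓`AlphaInputsT3AC.PkgAt.mainT_eq`), so a K-uniform bound on the action of the trivial-history composite minimiser over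
the height-`n` window IS the height-`n` member of LEAD w3-20520 g19's `hMainH`. [cite: Balaban1985UV3, (41)–(42) p.266, (5) p.256] -/
theorem mainTH_le_of_actionBoundH (h : AlphaInputsT3AC.Of F 𝔠) (γ : ℝ) (hγ : 0 < γ) (hγ1 : γ ≤ (min 𝔠.gamma0 1) ^ 2) (n : ℕ) {Cm : ℝ}
    (hA : ∀ (K : ℕ) (hK : n ≤ K) (W : GaugeField (F.P K) (K - n) (Matrix.specialUnitaryGroup (Fin 2) ℂ)),
      PlaqSmall (θBal F.L γ 𝔠.b₀ 𝔠.p₀ n) W →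
        (F.scheme ℰp γ).β K * wilsonAction4 ((h.pkgAt γ hγ hγ1 K).UkH (K - n) ((h.pkgAt γ hγ hγ1 K).T.triv (K - n)) W) ≤ Cm) :
    ∀ (K : ℕ) (hK : n ≤ K) (W : GaugeField (F.P K) (K - n) (Matrix.specialUnitaryGroup (Fin 2) ℂ)),
      PlaqSmall (θBal F.L γ 𝔠.b₀ 𝔠.p₀ n) W →
        (h.pkgAt γ hγ hγ1 K).T.mainT (K - n) ((h.pkgAt γ hγ hγ1 K).T.triv (K - n)) W ≤ Cm := by
  intro K hK W hW
  rw [(h.pkgAt γ hγ hγ1 K).mainT_eq (K - n) ((h.pkgAt γ hγ hγ1 K).T.triv (K - n)) W]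
  exact hA K hK W hW

/-! ## §3 `hMainH` VERBATIM from ONE membership row per height -/

/-- ★★★ **LEAD w3-20520 g19's `hMainH` FROM ONE MEMBERSHIP ROW PER HEIGHT.**  If for every height `n`, run `K ≥ n` and small height-`n` datum `W`
(`PlaqSmall (θBal F.L γ 𝔠.b₀ 𝔠.p₀ n) W`) the package's trivial-history composite minimiser `(h.pkgAt γ hγ hγ1 K).UkH (K − n) (triv) W` lies in print's regular fibre (6)
`regFibrePr F n K hK ε₀ V` over the height-`n` lattice for SOME datum `V` (the natural one is `W` itself relabelled, §3b), then `hMainH` holds VERBATIM with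
`Cm := 12·ε₀²·L^{3m+4n}∕γ` (§1 + §2).  The membership row = [Balaban1985Variational] Thm 1 (8) «U_k ∈ 𝔘_k(ε₀) ∩ 𝔅_k(V)» for the package's minimiser — the EX lane's content,
DISPLAYED, NOT proved here. [cite: Balaban1985Variational, Thm 1 (8) p.279, (6) p.278; Balaban1985UV3, (5) p.256, (11) p.258, (41) p.266] -/
theorem hMainH_of_membershipH (h : AlphaInputsT3AC.Of F 𝔠) (γ : ℝ) (hγ : 0 < γ) (hγ1 : γ ≤ (min 𝔠.gamma0 1) ^ 2) (ε₀ : ℝ)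
    (hmem : ∀ (n K : ℕ) (hK : n ≤ K) (W : GaugeField (F.P K) (K - n) (Matrix.specialUnitaryGroup (Fin 2) ℂ)),
      PlaqSmall (θBal F.L γ 𝔠.b₀ 𝔠.p₀ n) W →
        ∃ V : GaugeField (F.P n) 0 (Matrix.specialUnitaryGroup (Fin 2) ℂ),
          (h.pkgAt γ hγ hγ1 K).UkH (K - n) ((h.pkgAt γ hγ hγ1 K).T.triv (K - n)) W ∈ regFibrePr F n K hK ε₀ V) :
    ∀ n : ℕ, ∃ Cm : ℝ, ∀ (K : ℕ) (hK : n ≤ K) (W : GaugeField (F.P K) (K - n) (Matrix.specialUnitaryGroup (Fin 2) ℂ)),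
      PlaqSmall (θBal F.L γ 𝔠.b₀ 𝔠.p₀ n) W →
        (h.pkgAt γ hγ hγ1 K).T.mainT (K - n) ((h.pkgAt γ hγ hγ1 K).T.triv (K - n)) W ≤ Cm := by
  intro n
  refine ⟨12 * ε₀ ^ 2 * (F.L : ℝ) ^ (3 * F.m + 4 * n) / γ, mainTH_le_of_actionBoundH h γ hγ hγ1 n fun K hK W hW => ?_⟩
  obtain ⟨V, hV⟩ := hmem n K hK W hW
  exact beta_mul_wilsonAction4_le_of_regFibrePr_height F hγ ε₀ hK V hV

/-- ★★ **THE SAME WITH THE MEMBERSHIP READ OVER THE DATUM ITSELF** (print's shape: «U_k(V) ∈ 𝔘_k(ε₀) ∩ 𝔅_k(V)» for the datum `V` of which `U_k` is the minimiser):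
the height-`n` lattice of run `K` (level `K − n` of `F.P K`) IS level `0` of the `n`-th approximation (same modulus `2L^{m+n}`), the relabelling being
lit `T3LevelShift.fieldShift`; if the package's trivial-history composite minimiser over every small `W` lies in `regFibrePr F n K hK ε₀ (fieldShift _ W)`, then `hMainH`.
[cite: Balaban1985Variational, Thm 1 (8) p.279; Balaban1985UV3, (42) p.266] -/
theorem hMainH_of_membershipH_datum (h : AlphaInputsT3AC.Of F 𝔠) (γ : ℝ) (hγ : 0 < γ) (hγ1 : γ ≤ (min 𝔠.gamma0 1) ^ 2) (ε₀ : ℝ)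
    (hmem : ∀ (n K : ℕ) (hK : n ≤ K) (W : GaugeField (F.P K) (K - n) (Matrix.specialUnitaryGroup (Fin 2) ℂ)),
      PlaqSmall (θBal F.L γ 𝔠.b₀ 𝔠.p₀ n) W →
        (h.pkgAt γ hγ hγ1 K).UkH (K - n) ((h.pkgAt γ hγ hγ1 K).T.triv (K - n)) W ∈
          regFibrePr F n K hK ε₀
            (fieldShift (G := Matrix.specialUnitaryGroup (Fin 2) ℂ)
              (F.sitesPerDir_eq (m := F.m) (K := n) (j := 0) (m' := F.m) (K' := K) (j' := K - n) (by omega)) W)) :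
    ∀ n : ℕ, ∃ Cm : ℝ, ∀ (K : ℕ) (hK : n ≤ K) (W : GaugeField (F.P K) (K - n) (Matrix.specialUnitaryGroup (Fin 2) ℂ)),
      PlaqSmall (θBal F.L γ 𝔠.b₀ 𝔠.p₀ n) W →
        (h.pkgAt γ hγ hγ1 K).T.mainT (K - n) ((h.pkgAt γ hγ hγ1 K).T.triv (K - n)) W ≤ Cm :=
  hMainH_of_membershipH h γ hγ hγ1 ε₀ fun n K hK W hW => ⟨_, hmem n K hK W hW⟩

/-! ## §4 (★★OWNER WORD 103 (3)) The v3 record: the heightwise main-term row CLOSED from r1 -/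

/-- **`β_K·A(W′) ≤ 12·θ²·L^{3m+4n}∕γ` FOR ANY FINE FIELD WHOSE PLAQUETTES ARE `θ·L^{−2(K−n)}`-SMALL** — §1's arithmetic with the plaquette bound as the only input
(used at `K = n`, where the composite minimiser IS the datum and `regThreshold F n n θ = θ`). [cite: Balaban1985UV3, (11) p.258, (3)-(5) p.256] -/
theorem beta_mul_wilsonAction4_le_of_plaqSmall_regThreshold (F : T3Family) {γ : ℝ} (hγ : 0 < γ) (θ : ℝ) {n K : ℕ} (hK : n ≤ K)
    {U : GaugeField (F.P K) 0 (Matrix.specialUnitaryGroup (Fin 2) ℂ)} (hU : PlaqSmall (regThreshold F n K θ) U) :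
    (F.scheme ℰp γ).β K * wilsonAction4 U ≤ 12 * θ ^ 2 * (F.L : ℝ) ^ (3 * F.m + 4 * n) / γ := by
  obtain ⟨d, rfl⟩ := Nat.exists_eq_add_of_le hK
  have hL : (1 : ℝ) < F.L := by exact_mod_cast F.hL.2
  have hL0 : (0 : ℝ) < F.L := zero_lt_one.trans hL
  have hβ : (F.scheme ℰp γ).β (n + d) = (γ * ((F.L : ℝ)⁻¹) ^ (n + d))⁻¹ := rfl
  have hβ0 : 0 ≤ (F.scheme ℰp γ).β (n + d) := F.scheme_β_nonneg ℰp hγ.le _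
  have hsite : Fintype.card (Site (F.P (n + d)) 0) = (2 * F.L ^ (F.m + (n + d))) ^ 3 := by
    rw [show Fintype.card (Site (F.P (n + d)) 0) = Fintype.card (Fin 3 → ZMod ((F.P (n + d)).sitesPerDir 0)) from
      Fintype.card_congr (Equiv.refl _)]
    rw [Fintype.card_fun, ZMod.card, Fintype.card_fin]
    simp [Params.sitesPerDir]
  have hplaq : (Fintype.card (Plaq (F.P (n + d)) 0) : ℝ) = 24 * (F.L : ℝ) ^ (3 * F.m + 3 * (n + d)) := by
    rw [B10Eq41TorusHistories.card_plaq_three (F.P_d (n + d)) 0, hsite]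
    push_cast
    ring
  have ht : regThreshold F n (n + d) θ = θ * ((F.L : ℝ)⁻¹) ^ (2 * d) := by
    show θ * ((F.L : ℝ)⁻¹) ^ (2 * (n + d - n)) = _
    rw [Nat.add_sub_cancel_left]
  have hA : wilsonAction4 U ≤ (Fintype.card (Plaq (F.P (n + d)) 0) : ℝ) * ((1 / 2) * (θ * ((F.L : ℝ)⁻¹) ^ (2 * d)) ^ 2) := by
    unfold wilsonAction4 wilsonAction
    calc ∑ p : Plaq (F.P (n + d)) 0, (1 : ℝ) * (1 - reTr (GaugeField.plaqHol U p))
        ≤ ∑ _p : Plaq (F.P (n + d)) 0, (1 / 2) * (θ * ((F.L : ℝ)⁻¹) ^ (2 * d)) ^ 2 := by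
          refine Finset.sum_le_sum fun p _ => ?_
          rw [one_mul]
          have h1 := B10Eq5RegularAction.one_sub_reTr_le_specialUnitaryGroup (GaugeField.plaqHol U p)
          have h2 : dist1 (GaugeField.plaqHol U p) < θ * ((F.L : ℝ)⁻¹) ^ (2 * d) := ht ▸ hU p
          have h3 : 0 ≤ dist1 (GaugeField.plaqHol U p) := GaugeGroup.dist1_nonneg _
          nlinarith [h1, h2, h3, sq_nonneg (dist1 (GaugeField.plaqHol U p)), mul_self_le_mul_self h3 h2.le]
      _ = (Fintype.card (Plaq (F.P (n + d)) 0) : ℝ) * ((1 / 2) * (θ * ((F.L : ℝ)⁻¹) ^ (2 * d)) ^ 2) := by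
          rw [Finset.sum_const, Finset.card_univ, nsmul_eq_mul]
  calc (F.scheme ℰp γ).β (n + d) * wilsonAction4 U
      ≤ (F.scheme ℰp γ).β (n + d) * ((Fintype.card (Plaq (F.P (n + d)) 0) : ℝ) * ((1 / 2) * (θ * ((F.L : ℝ)⁻¹) ^ (2 * d)) ^ 2)) :=
        mul_le_mul_of_nonneg_left hA hβ0
    _ = 12 * θ ^ 2 * (F.L : ℝ) ^ (3 * F.m + 4 * n) / γ := by
        rw [hβ, hplaq]
        have hLd : ((F.L : ℝ)⁻¹) ^ (2 * d) = ((F.L : ℝ) ^ (2 * d))⁻¹ := by rw [inv_pow]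
        rw [hLd, inv_pow]
        have e1 : (F.L : ℝ) ^ (3 * F.m + 3 * (n + d)) = (F.L : ℝ) ^ (3 * F.m + 4 * n) * (F.L : ℝ) ^ (3 * d) / (F.L : ℝ) ^ n := by
          rw [eq_div_iff (pow_ne_zero _ hL0.ne'), ← pow_add, ← pow_add]; congr 1; ring
        have e2 : (F.L : ℝ) ^ (n + d) = (F.L : ℝ) ^ n * (F.L : ℝ) ^ d := pow_add _ _ _
        have e3 : (F.L : ℝ) ^ (2 * d) = (F.L : ℝ) ^ d * (F.L : ℝ) ^ d := by rw [← pow_add]; congr 1; ring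
        have e4 : (F.L : ℝ) ^ (3 * d) = (F.L : ℝ) ^ d * (F.L : ℝ) ^ d * (F.L : ℝ) ^ d := by rw [← pow_add, ← pow_add]; congr 1; ring
        rw [e1, e2, e3, e4]
        have hLn : (F.L : ℝ) ^ n ≠ 0 := pow_ne_zero _ hL0.ne'
        have hLd0 : (F.L : ℝ) ^ d ≠ 0 := pow_ne_zero _ hL0.ne'
        field_simp
        ring

variable {a₀ a₁ : ℝ}

/-- ★★★★ **THE HEIGHTWISE MAIN-TERM ROW FOR THE VERSION-3 PACKAGE, CLOSED** (★★OWNER WORD 103 (3); LEAD w3-20520 g19's `hMainH` shape with `h.pkgAt ↦ h.pkgAtV3 hc`):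
for `h : AlphaInputsT3AC.OfV3At F 𝔠 a₀ a₁` (`0 < a₀`, `0 < a₁`, `B₃a₁ ≤ a₀`), a coupling `γ` in the (α)-window, and the two γ-WINDOW LETTERS `θBal(n) ≤ a₁` and `B₃·θBal(n) ≤ a₀`
for every height `n` (lit ✓`T3ThresholdSmallness.exists_forall_θBal_le` gives both for `γ ≤ γ₁(L, 𝔠, a₀, a₁)`), for EVERY height `n` ONE constant
`Cm := 12·(max a₀ θBal(n))²·L^{3m+4n}∕γ` bounds the package's trivial-history main term `mainT_{K−n}(triv, W)` over every small height-`n` datum `W`, for EVERY run `K ≥ n`: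
`n < K` — the v3 minimiser row r1 ✓`PkgAtV3.uminTriv_mem_regFibrePr` at `ε₁ := θBal(n)`, `ε₀ := a₀` (datum `V := W` relabelled by lit `fieldShift`, plaquettes preserved,
lit ✓`T3CruxEstimates.plaqSmall_fieldShift`) puts `U_{K−n}(triv, W)` in `regFibrePr F n K _ a₀ V`, and §1 bounds its action; `K = n` — `U_0(triv, W) = W` (`hU0`) and the
datum's own smallness through §4's first lemma (`regThreshold F n n θ = θ`).  NO displayed row beyond the v3 package and the two window letters.
[cite: Balaban1985Variational, Thm 1 (8) p.279, (6) p.278; Balaban1985UV3, (5) p.256, (11) p.258, (41)-(42) p.266] -/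
theorem hMainH_v3 (h : AlphaInputsT3AC.OfV3At F 𝔠 a₀ a₁) (hc : 0 < a₀ ∧ 0 < a₁ ∧ 𝔠.B₃ * a₁ ≤ a₀)
    (γ : ℝ) (hγ : 0 < γ) (hγ1 : γ ≤ (min 𝔠.gamma0 1) ^ 2)
    (hθ₁ : ∀ n : ℕ, θBal F.L γ 𝔠.b₀ 𝔠.p₀ n ≤ a₁) (hθ₀ : ∀ n : ℕ, 𝔠.B₃ * θBal F.L γ 𝔠.b₀ 𝔠.p₀ n ≤ a₀) :
    ∀ n : ℕ, ∃ Cm : ℝ, ∀ (K : ℕ) (hK : n ≤ K) (W : GaugeField (F.P K) (K - n) (Matrix.specialUnitaryGroup (Fin 2) ℂ)),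
      PlaqSmall (θBal F.L γ 𝔠.b₀ 𝔠.p₀ n) W →
        (h.pkgAtV3 hc γ hγ hγ1 K).T.mainT (K - n) ((h.pkgAtV3 hc γ hγ hγ1 K).T.triv (K - n)) W ≤ Cm := by
  intro n
  have hL1 : 1 ≤ F.L := F.hL.2.le
  have hγ1' : γ ≤ 1 := hγ1.trans (sq_min_one_le _ 𝔠.gamma0_pos)
  set θ := θBal F.L γ 𝔠.b₀ 𝔠.p₀ n with hθ
  have hθpos : 0 < θ := T3MinimiserStabilityReduction.θBal_pos hL1 hγ hγ1' 𝔠.b₀_pos 𝔠.p₀ n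
  refine ⟨12 * (max a₀ θ) ^ 2 * (F.L : ℝ) ^ (3 * F.m + 4 * n) / γ, fun K hK W hW => ?_⟩
  have hmono : ∀ {x : ℝ}, x ^ 2 ≤ (max a₀ θ) ^ 2 → 12 * x ^ 2 * (F.L : ℝ) ^ (3 * F.m + 4 * n) / γ ≤
      12 * (max a₀ θ) ^ 2 * (F.L : ℝ) ^ (3 * F.m + 4 * n) / γ := fun hx => by
    have hL0 : (0 : ℝ) ≤ (F.L : ℝ) ^ (3 * F.m + 4 * n) := by positivity
    exact div_le_div_of_nonneg_right (by nlinarith [hL0]) hγ.le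
  rw [(h.pkgAtV3 hc γ hγ hγ1 K).mainT_eq (K - n) ((h.pkgAtV3 hc γ hγ hγ1 K).T.triv (K - n)) W]
  rcases hK.eq_or_lt with rfl | hnK
  · -- `K = n`: the composite minimiser of the trivial history at level `0 = n − n` is the datum itself (`hU0`)
    have hth : regThreshold F n n θ = θ := by
      show θ * ((F.L : ℝ)⁻¹) ^ (2 * (n - n)) = θ
      rw [Nat.sub_self, Nat.mul_zero, pow_zero, mul_one]
    have key : ∀ (j : ℕ), j = 0 → ∀ W' : GaugeField (F.P n) j (Matrix.specialUnitaryGroup (Fin 2) ℂ),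
        PlaqSmall θ W' → PlaqSmall θ ((h.pkgAtV3 hc γ hγ hγ1 n).UkH j ((h.pkgAtV3 hc γ hγ hγ1 n).T.triv j) W') := by
      intro j hj W' hW'
      subst hj
      rw [show (h.pkgAtV3 hc γ hγ hγ1 n).UkH 0 ((h.pkgAtV3 hc γ hγ hγ1 n).T.triv 0) W' = W' from (h.pkgAtV3 hc γ hγ hγ1 n).hU0 W']
      exact hW'
    have hW' : PlaqSmall (regThreshold F n n θ) ((h.pkgAtV3 hc γ hγ hγ1 n).UkH (n - n) ((h.pkgAtV3 hc γ hγ hγ1 n).T.triv (n - n)) W) := by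
      rw [hth]
      exact key (n - n) (Nat.sub_self n) W hW
    exact (beta_mul_wilsonAction4_le_of_plaqSmall_regThreshold F hγ θ le_rfl hW').trans
      (hmono (pow_le_pow_left₀ hθpos.le (le_max_right _ _) 2))
  · -- `n < K`: the minimiser row r1 puts `U_{K−n}(triv, W)` in print's regular fibre over the datum `W` read at height `n`
    have ha₁ : θ ≤ (h.pkgAtV3 hc γ hγ hγ1 K).a₁ := by rw [h.pkgAtV3_a₁ hc γ hγ hγ1 K]; exact hθ₁ n
    have ha₀ : a₀ ≤ (h.pkgAtV3 hc γ hγ hγ1 K).a₀ := by rw [h.pkgAtV3_a₀ hc γ hγ hγ1 K]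
    have hs : (F.PP F.m K).sitesPerDir (K - n) = (F.PP F.m n).sitesPerDir 0 :=
      F.sitesPerDir_eq (m := F.m) (K := K) (j := K - n) (m' := F.m) (K' := n) (j' := 0) (by omega)
    set V : GaugeField (F.P n) 0 (Matrix.specialUnitaryGroup (Fin 2) ℂ) := fieldShift hs.symm W with hV
    have hVsmall : PlaqSmall θ V := (T3CruxEstimates.plaqSmall_fieldShift F hs.symm θ W).mpr hW
    have hWV : fieldShift hs V = W := T3LevelShift.fieldShift_symm_fieldShift hs W
    have hmem := (h.pkgAtV3 hc γ hγ hγ1 K).uminTriv_mem_regFibrePr hnK hθpos ha₁ (hθ₀ n) ha₀ V hVsmall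
    rw [hWV] at hmem
    exact (beta_mul_wilsonAction4_le_of_regFibrePr_height F hγ a₀ hnK.le V hmem).trans
      (hmono (pow_le_pow_left₀ hc.1.le (le_max_left _ _) 2))

end Summit.QuantumFields.YangMills.Theorems.FluctuationComparisonRegPrIntLHeightwiseMainTermOfMembership

end
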